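import Summits.ResolutionOfSingularities.ResolutionOfSingularities.Theorems.HomologicalConductorNoZenoDim2RegularCentre
import Summits.ResolutionOfSingularities.ResolutionOfSingularities.Theorems.HomologicalConductorNoZenoDim2Exhaustion
import Summits.ResolutionOfSingularities.ResolutionOfSingularities.Theorems.HomologicalConductorNoZenoUnitOfRegularCentre
import Summits.ResolutionOfSingularities.ResolutionOfSingularities.Theorems.HomologicalConductorNoZenoExitDivisor
import Literature.RingTheory.CohomologyAnnihilator.ModuleDescentFiniteSubextension
import Literature.RingTheory.CohomologyAnnihilator.Completion
import HarnessLib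

/-!
# Crux `NoZenoR` (stmt-ResolutionOfSingularities-19943) = `NoZeno` (stmt-16483), line `birth` / `sandwich-cluster`:
# Layer 0 of S3 `stub_caPrincipalUpstairs` — `ca(T_m)` is a unit upstairs away from the dominated points

OURS (cell res-hironaka, chain W4.4; lead res-L0-w44-lead-1, STUB-PLAN-stub_caPrincipalUpstairs.md Layer 0).
S3 = (Q_val) asks, for a late stage `T = tower O A m` (`m ≥ m₀ + 1`) and EVERY regular local `S ⊇ T`,
that `ca(T)·S` be principal. The mathematics is settled on paper (res-L0-w44-idea-1's THEOREM Q-rat,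
audited KERNEL-L0 §14); this file lands the tree-vocabulary REDUCTIONS that leave only the regular local
rings `S` DOMINATING `T` (the closed points of models above `T`) — in transcendence degree ≤ 2:

* `tower_isIsolatedSingularity` — a (local) stage `T_(n+1)` (normal of dimension ≤ 2) is an isolated singularity;
* `exists_coe_mem_ca_not_mem` — hence `ca(T_(n+1)) ⊄ 𝔭` for every non-maximal prime `𝔭`
  (`Sing = V(ca)`, Iyengar–Takahashi 5.4 = the tree's `singEqVCa_essFiniteType_holds`);
* `span_ca_eq_top_of_isRegularLocalRing` — a regular stage has `ca·S = S` for every `S ⊇ T`;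
* `span_ca_eq_top_of_not_dominates` — if the local `S ⊇ T` does NOT dominate `T` (some non-unit of
  `T` is a unit of `S`), then `ca(T)·S = S` — in particular principal.

References: S. Iyengar, R. Takahashi, IMRN 2016, Thm 5.4 [`IyengarTakahashi2014`]; H. Matsumura,
*Commutative Ring Theory*, Thm 11.2/11.5 (normal of dimension ≤ 2 ⇒ isolated singularity)
[`Matsumura1987`].
-/

-- single-problem summit: the doubled namespace component `ResolutionOfSingularities` is forced
set_option linter.dupNamespace false

noncomputable section

namespace Summit.ResolutionOfSingularities.ResolutionOfSingularities.Theorems.NoZeno.Birth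

open IsLocalRing Literature.AlgebraicGeometry.Resolution Literature.RingTheory.CohomologyAnnihilator

variable {k K : Type} [Field k] [Field K] [Algebra k K]

/-- **A normalised stage is an isolated singularity** (transcendence degree ≤ 2): `T_(n+1)` is a
normal noetherian local domain of Krull dimension ≤ 2, hence regular in codimension ≤ 1.
[cite: Matsumura1987, Thm. 11.5] -/
theorem tower_isIsolatedSingularity (O : ValuationSubring K) (A : Subalgebra k K)
    (hk : ∀ c : k, algebraMap k K c ∈ O) (hA : A.FG) (hfr : IsFractionRing ↥A K)
    (hAO : A.toSubring ≤ O.toSubring) (htr : Algebra.trdeg k K ≤ 2) (n : ℕ)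
    [IsLocalRing ↥(tower O A (n + 1))] : IsIsolatedSingularity ↥(tower O A (n + 1)) := by
  haveI : IsNoetherianRing ↥(tower O A (n + 1)) := stub_towerNoetherian k K O A hk hA hfr hAO (n + 1)
  haveI : IsIntegrallyClosed ↥(tower O A (n + 1)) := d2rc_isIntegrallyClosed_tower_succ O A hk hA hfr hAO n
  exact isIsolatedSingularity_of_isIntegrallyClosed_of_ringKrullDim_le_two
    (d2rc_ringKrullDim_tower_le O A (n + 1) htr)

/-- **`ca` of a normalised stage misses every non-maximal prime** (`Sing T = V(ca T)`,
Iyengar–Takahashi 5.4, at a prime where `T_𝔭` is regular). [cite: IyengarTakahashi2014, Thm. 5.4] -/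
theorem exists_coe_mem_ca_not_mem (O : ValuationSubring K) (A : Subalgebra k K)
    (hk : ∀ c : k, algebraMap k K c ∈ O) (hA : A.FG) (hfr : IsFractionRing ↥A K)
    (hAO : A.toSubring ≤ O.toSubring) (m : ℕ) (𝔭 : Ideal ↥(tower O A m)) [𝔭.IsPrime]
    (hreg : IsRegularLocalRing (Localization.AtPrime 𝔭)) :
    ∃ c : ↥(tower O A m), (c : K) ∈ ca (tower O A m) ∧ c ∉ 𝔭 := by
  -- adapted from `stub_unitOfRegularCentre` (p173854)
  obtain ⟨-, -, hET⟩ := tn_tower_invariant O A hk hA hfr hAO m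
  haveI := hET
  obtain ⟨d, hd, -⟩ := exists_ringKrullDim_eq_and_trdeg_eq k
    ↥(Algebra.EssFiniteType.subalgebra k ↥(tower O A m))
  have key : Literature.RingTheory.CohomologyAnnihilator.ca ↥(tower O A m) ≤ 𝔭 ↔
      ¬ IsRegularLocalRing (Localization.AtPrime 𝔭) :=
    (singEqVCa_essFiniteType_holds k ↥(Algebra.EssFiniteType.subalgebra k ↥(tower O A m))
      inferInstance d hd (Algebra.EssFiniteType.submonoid k ↥(tower O A m)) ↥(tower O A m)
      inferInstance 𝔭).1
  have hnot : ¬ Literature.RingTheory.CohomologyAnnihilator.ca ↥(tower O A m) ≤ 𝔭 :=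
    fun h => key.mp h hreg
  obtain ⟨c, hc, hc𝔭⟩ := SetLike.not_le_iff_exists.mp hnot
  rw [ca_eq_cohomologyAnnihilator] at hc
  exact ⟨c, (tn_coe_mem_ca_iff (tower O A m) c).mpr hc, hc𝔭⟩

/-- **Layer 0, regular stage.** If the stage `T` is regular, `ca(T)` contains a unit of `T`, so
`ca(T)·S = S` for every `k`-subalgebra `S ⊇ T`. [cite: IyengarTakahashi2014, Thm. 5.4] -/
theorem span_ca_eq_top_of_isRegularLocalRing (O : ValuationSubring K) (A : Subalgebra k K)
    (hk : ∀ c : k, algebraMap k K c ∈ O) (hA : A.FG) (hfr : IsFractionRing ↥A K)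
    (hAO : A.toSubring ≤ O.toSubring) (m : ℕ) (hreg : IsRegularLocalRing ↥(tower O A m))
    (S : Subalgebra k K) (hTS : tower O A m ≤ S) :
    Ideal.span {s : ↥S | (s : K) ∈ ca (tower O A m)} = ⊤ := by
  haveI := hreg
  have hreg' : IsRegularLocalRing (Localization.AtPrime (maximalIdeal ↥(tower O A m))) :=
    (SandwichCluster.isRegularLocalRing_atPrime_maximalIdeal_iff _).mpr hreg
  obtain ⟨c, hc, hcm⟩ := exists_coe_mem_ca_not_mem O A hk hA hfr hAO m (maximalIdeal _) hreg'
  have hcu : IsUnit c := by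
    by_contra h
    exact hcm ((IsLocalRing.mem_maximalIdeal _).mpr h)
  rw [Ideal.eq_top_iff_one]
  have hcS : IsUnit (Subalgebra.inclusion hTS c) := hcu.map _
  have hmem : Subalgebra.inclusion hTS c ∈ Ideal.span {s : ↥S | (s : K) ∈ ca (tower O A m)} :=
    Ideal.subset_span hc
  exact (Ideal.span {s : ↥S | (s : K) ∈ ca (tower O A m)}).eq_top_of_isUnit_mem hmem hcS ▸
    Submodule.mem_top

/-- **Layer 0, non-dominated points** (transcendence degree ≤ 2): if `S ⊇ T_(n+1)` is a local
`k`-subalgebra of `K` that does NOT dominate the stage — some `t ∈ T_(n+1)` is a non-unit of `T_(n+1)`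
but a unit of `S` — then `ca(T_(n+1))·S = S`. Indeed `𝔭 = 𝔪_S ∩ T` is a non-maximal prime of the
isolated singularity `T`, so `T_𝔭` is regular and `ca(T) ⊄ 𝔭`. [cite: IyengarTakahashi2014, Thm. 5.4] -/
theorem span_ca_eq_top_of_not_dominates (O : ValuationSubring K) (A : Subalgebra k K)
    (hk : ∀ c : k, algebraMap k K c ∈ O) (hA : A.FG) (hfr : IsFractionRing ↥A K)
    (hAO : A.toSubring ≤ O.toSubring) (htr : Algebra.trdeg k K ≤ 2) (n : ℕ)
    (S : Subalgebra k K) [IsLocalRing ↥S] (hTS : tower O A (n + 1) ≤ S)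
    (hnd : ∃ t : ↥(tower O A (n + 1)), ¬ IsUnit t ∧ IsUnit (Subalgebra.inclusion hTS t)) :
    Ideal.span {s : ↥S | (s : K) ∈ ca (tower O A (n + 1))} = ⊤ := by
  -- the stage is local: it is `loc O B` for some `B ⊆ O`
  haveI : IsLocalRing ↥(tower O A (n + 1)) := by
    obtain ⟨B, hBO, hTB⟩ := exists_tower_eq_loc O A hk hAO (n + 1)
    rw [hTB, loc_eq_locAt]
    exact SyzygyFlattening.isLocalRing_locAt O B hBO
  set 𝔭 : Ideal ↥(tower O A (n + 1)) :=
    (maximalIdeal ↥S).comap (Subalgebra.inclusion hTS).toRingHom with h𝔭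
  haveI : 𝔭.IsPrime := Ideal.comap_isPrime _ _
  have hne : 𝔭 ≠ maximalIdeal ↥(tower O A (n + 1)) := by
    obtain ⟨t, ht, htS⟩ := hnd
    intro heq
    have htm : t ∈ maximalIdeal ↥(tower O A (n + 1)) := (IsLocalRing.mem_maximalIdeal _).mpr ht
    rw [← heq, h𝔭, Ideal.mem_comap] at htm
    exact ((IsLocalRing.mem_maximalIdeal _).mp htm) htS
  have hreg : IsRegularLocalRing (Localization.AtPrime 𝔭) :=
    tower_isIsolatedSingularity O A hk hA hfr hAO htr n 𝔭 hne
  obtain ⟨c, hc, hc𝔭⟩ := exists_coe_mem_ca_not_mem O A hk hA hfr hAO (n + 1) 𝔭 hreg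
  have hcS : IsUnit (Subalgebra.inclusion hTS c) := by
    by_contra h
    exact hc𝔭 (by rw [h𝔭, Ideal.mem_comap]; exact (IsLocalRing.mem_maximalIdeal _).mpr h)
  have hmem : Subalgebra.inclusion hTS c ∈ Ideal.span {s : ↥S | (s : K) ∈ ca (tower O A (n + 1))} :=
    Ideal.subset_span hc
  exact Ideal.eq_top_of_isUnit_mem _ hmem hcS

/-- **Corollary (the form S3 consumes).** Away from the points dominating the stage, the ideal of S3 is
principal (it is the unit ideal). [cite: IyengarTakahashi2014, Thm. 5.4] -/
theorem isPrincipal_span_ca_of_not_dominates (O : ValuationSubring K) (A : Subalgebra k K)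
    (hk : ∀ c : k, algebraMap k K c ∈ O) (hA : A.FG) (hfr : IsFractionRing ↥A K)
    (hAO : A.toSubring ≤ O.toSubring) (htr : Algebra.trdeg k K ≤ 2) (n : ℕ)
    (S : Subalgebra k K) [IsLocalRing ↥S] (hTS : tower O A (n + 1) ≤ S)
    (hnd : ∃ t : ↥(tower O A (n + 1)), ¬ IsUnit t ∧ IsUnit (Subalgebra.inclusion hTS t)) :
    (Ideal.span {s : ↥S | (s : K) ∈ ca (tower O A (n + 1))}).IsPrincipal := by
  rw [span_ca_eq_top_of_not_dominates O A hk hA hfr hAO htr n S hTS hnd]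
  exact ⟨⟨1, by simp⟩⟩

end Summit.ResolutionOfSingularities.ResolutionOfSingularities.Theorems.NoZeno.Birth

end
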